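import Mathlib

/-!
# T⁴ programme, spine node NE2 (U1a) — THE LATTICE WEITZENBÖCK IDENTITY (abstract, exact): for ANY family of «covariant differences»
# `∇_μ` on a finite space, `½·curlᴴcurl + divᴴdiv = rough Laplacian + commutator blocks [∇_ν, ∇_μᴴ]`
# (the algebraic heart of the owner's scope-note delta Δ5: [B9] (3.10)'s covariant-curl form vs row B2's componentwise operator)

Tenth generation of the NE2 prover lineage P1 of the cell `pub-balaban`, file 6.  [Balaban1985BackgroundPropagators] (3.3)–(3.4) p.391 define the
covariant derivative of a 1-form at a plaquette `p = (x, x+ηe_μ, x+ηe_μ+ηe_ν, x+ηe_ν)` as «(D A)(p) = η^{−1}(A(x,y) + R(U₀(x,y))A(y,z) + … )»,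
i.e. `(DA)_{μν}(x) = (D_μA_ν)(x) − (D_νA_μ)(x)` with `(D_μA_ν)(x) = η^{−1}(R(U(x,x+ηe_μ))A_ν(x+ηe_μ) − A_ν(x))`, and (3.10) p.392 takes the quadratic
part of the Wilson action as «the basic operator generalizing the operator d*d».  Row B2 of the tier-B skeleton (`Support/ColourCovariantLaplacian`)
covariantises the COMPONENTWISE («rough») Laplacian `Σ_μ D_μᴴD_μ` instead.  This file proves, in complete abstraction (any finite index set `S`,
any family `∇ : Fin d → Matrix S S ℂ` — no lattice, no transporters, no unitarity), the exact identity relating the two: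

  **`weitzenbock`**: `(1/2)•(curlOp ∇)ᴴ·curlOp ∇ + (divOp ∇)ᴴ·divOp ∇ = roughOp ∇ + commOp ∇`,

where on 1-forms `Fin d × S`: `curlOp ∇ : ((Fin d × Fin d) × S) ← (Fin d × S)`, `(curl A)_{(μ,ν)} = ∇_μA_ν − ∇_νA_μ` (ordered pairs, whence the ½);
`divOp ∇ : S ← (Fin d × S)`, `div A = Σ_κ ∇_κᴴA_κ` (so `divᴴ = grad`, `divᴴdiv = dd*`); `roughOp ∇` = the block-diagonal `Σ_λ ∇_λᴴ∇_λ`;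
`commOp ∇` = the block operator with `(ν, μ)` block `∇_ν∇_μᴴ − ∇_μᴴ∇_ν = [∇_ν, ∇_μᴴ]`.  For covariant lattice differences `∇_μ = c(T_μ − 1)`,
`T_μ = siteMul(R_μ)·S_μ`, the commutator `[∇_ν, ∇_μᴴ] = c²[T_ν, T_μᴴ]` is the HOLONOMY DEFECT around the plaquette times the mixed two-step shift —
the carrier of `Support/ShiftedZerothOrder.Smix` (p208714/p209079) — and it VANISHES in the flat case (shifts commute), recovering
[Balaban1984PropagatorsI] (1.21)/(1.69) «Δ = ∂*∂ + ∂∂*» = the componentwise Laplacian.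

 * §1 the block operators (`oneOp`, `curlOp`, `divOp`, `roughOp`, `commOp`) and their entry formulas;
 * §2 the entry computations `curl_gram_apply` (`(curlᴴcurl)_{(κ,s),(κ′,s′)} = 2[κ=κ′](Σ_λ∇_λᴴ∇_λ)_{ss′} − 2(∇_{κ′}ᴴ∇_κ)_{ss′}`), `div_gram_apply`
   (`(divᴴdiv)_{(κ,s),(κ′,s′)} = (∇_κ∇_{κ′}ᴴ)_{ss′}`), and **`weitzenbock`**; the flat corollary **`weitzenbock_of_commute`** (pairwise
   `∇_ν∇_μᴴ = ∇_μᴴ∇_ν` ⟹ Hodge = rough).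

HONEST FRAMING (T4-DAG p. 1).  Pure finite-dimensional algebra ([folklore]); it identifies WHICH operator the tier-B row B2 would have to add to
model (3.10)'s principal part (the commutator blocks, catalogued by `ShiftedZerothOrder`), it does NOT assert the dictionary B0 (that the Hessian of
the Wilson action IS `½curlᴴcurl` + the printed commutator term Δ′ — the b05/an2 lineages' reading), constructs no transporter, and changes nothing in
the countdown; NE2 NOT PROVED; spine 0/9; NOT infinite volume / mass gap / Clay.  HONEST DEPENDENCY: continuum YM on T⁴ ⇐ BetaPertH ∧ nine spine
estimates (0/9 proved); BetaPertH ⇐ (D1) ∧ (D4) ∧ CAP+tail; G-an2-4 gates asym, D1 and NE2/3/4.  ABSOLUTE RULE kept; no `sorry`.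
-/

noncomputable section

open scoped BigOperators ComplexConjugate Matrix

namespace Summit.QuantumFields.BalabanUV.T4Continuum.LatticeWeitzenbock

variable {d : ℕ} {S : Type*} [Fintype S]

/-! ## §1 Block operators on lattice forms -/

/-- the 1-form operator with `S × S` blocks `B κ κ′`. [folklore] -/
def oneOp (B : Fin d → Fin d → Matrix S S ℂ) : Matrix (Fin d × S) (Fin d × S) ℂ :=
  Matrix.of fun i j => B i.1 j.1 i.2 j.2

/-- the first half of the curl: `(cA A)_{(μ,ν)} = ∇_μ A_ν`. [folklore] -/
def cA (D : Fin d → Matrix S S ℂ) : Matrix ((Fin d × Fin d) × S) (Fin d × S) ℂ :=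
  Matrix.of fun p j => if j.1 = p.1.2 then D p.1.1 p.2 j.2 else 0

/-- the second half of the curl: `(cB A)_{(μ,ν)} = ∇_ν A_μ`. [folklore] -/
def cB (D : Fin d → Matrix S S ℂ) : Matrix ((Fin d × Fin d) × S) (Fin d × S) ℂ :=
  Matrix.of fun p j => if j.1 = p.1.1 then D p.1.2 p.2 j.2 else 0

/-- **THE LATTICE CURL** on 1-forms (ordered pairs): `(curl A)_{(μ,ν)} = ∇_μA_ν − ∇_νA_μ` — the linearisation of the plaquette variable,
[Balaban1985BackgroundPropagators] (3.3)–(3.4) p.391 (shape). [folklore] -/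
def curlOp (D : Fin d → Matrix S S ℂ) : Matrix ((Fin d × Fin d) × S) (Fin d × S) ℂ := cA D - cB D

/-- **THE LATTICE (COVARIANT) DIVERGENCE** `div A = Σ_κ ∇_κᴴ A_κ` (`divᴴ` = the gradient). [cite: Balaban1985BackgroundPropagators, (3.8) p.392
(shape)] [folklore] -/
def divOp (D : Fin d → Matrix S S ℂ) : Matrix S (Fin d × S) ℂ :=
  Matrix.of fun s j => (D j.1)ᴴ s j.2

/-- **THE ROUGH (COMPONENTWISE) LAPLACIAN** `Σ_λ ∇_λᴴ∇_λ` on every component (row B2's operator, abstractly). [folklore] -/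
def roughOp (D : Fin d → Matrix S S ℂ) : Matrix (Fin d × S) (Fin d × S) ℂ :=
  oneOp fun κ κ' => if κ = κ' then ∑ l, (D l)ᴴ * D l else 0

/-- **THE COMMUTATOR BLOCKS** `(ν, μ) ↦ [∇_ν, ∇_μᴴ] = ∇_ν∇_μᴴ − ∇_μᴴ∇_ν` (holonomy defects; zero when the `∇`'s commute with the adjoints).
[folklore] -/
def commOp (D : Fin d → Matrix S S ℂ) : Matrix (Fin d × S) (Fin d × S) ℂ :=
  oneOp fun ν μ => D ν * (D μ)ᴴ - (D μ)ᴴ * D ν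

/-! ## §2 The Gram entries and the identity -/

/-- a sum over `(Fin d × Fin d) × S` as an iterated sum. [folklore] -/
theorem sum_pairs_sites (f : (Fin d × Fin d) × S → ℂ) : ∑ p, f p = ∑ μ : Fin d, ∑ ν : Fin d, ∑ u : S, f ((μ, ν), u) := by
  rw [Fintype.sum_prod_type, Fintype.sum_prod_type]

/-- `(cAᴴcA)_{(κ,s),(κ′,s′)} = [κ = κ′]·Σ_μ (∇_μᴴ∇_μ)_{ss′}`. [folklore] -/
theorem cA_gram_apply (D : Fin d → Matrix S S ℂ) (κ κ' : Fin d) (s s' : S) :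
    ((cA D)ᴴ * cA D) (κ, s) (κ', s') = if κ = κ' then (∑ l, (D l)ᴴ * D l) s s' else 0 := by
  rw [Matrix.mul_apply, sum_pairs_sites]
  simp only [cA, Matrix.conjTranspose_apply, Matrix.of_apply]
  by_cases h : κ = κ'
  · subst h
    rw [if_pos rfl, Matrix.sum_apply]
    refine Finset.sum_congr rfl fun μ _ => ?_
    rw [Matrix.mul_apply, Finset.sum_comm]
    refine Finset.sum_congr rfl fun u _ => ?_
    rw [Finset.sum_eq_single κ]
    · simp only [if_true, Matrix.conjTranspose_apply]
    · intro x _ hx; rw [if_neg (Ne.symm hx)]; simp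
    · intro hk; exact absurd (Finset.mem_univ κ) hk
  · rw [if_neg h]
    refine Finset.sum_eq_zero fun μ _ => Finset.sum_eq_zero fun ν _ => Finset.sum_eq_zero fun u _ => ?_
    by_cases h1 : κ = ν
    · subst h1; rw [if_neg (Ne.symm h)]; simp
    · rw [if_neg h1]; simp

/-- `(cBᴴcB)_{(κ,s),(κ′,s′)} = [κ = κ′]·Σ_ν (∇_νᴴ∇_ν)_{ss′}`. [folklore] -/
theorem cB_gram_apply (D : Fin d → Matrix S S ℂ) (κ κ' : Fin d) (s s' : S) :
    ((cB D)ᴴ * cB D) (κ, s) (κ', s') = if κ = κ' then (∑ l, (D l)ᴴ * D l) s s' else 0 := by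
  rw [Matrix.mul_apply, sum_pairs_sites, Finset.sum_comm]
  simp only [cB, Matrix.conjTranspose_apply, Matrix.of_apply]
  by_cases h : κ = κ'
  · subst h
    rw [if_pos rfl, Matrix.sum_apply]
    refine Finset.sum_congr rfl fun ν _ => ?_
    rw [Matrix.mul_apply, Finset.sum_comm]
    refine Finset.sum_congr rfl fun u _ => ?_
    rw [Finset.sum_eq_single κ]
    · simp only [if_true, Matrix.conjTranspose_apply]
    · intro x _ hx; rw [if_neg (Ne.symm hx)]; simp
    · intro hk; exact absurd (Finset.mem_univ κ) hk
  · rw [if_neg h]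
    refine Finset.sum_eq_zero fun ν _ => Finset.sum_eq_zero fun μ _ => Finset.sum_eq_zero fun u _ => ?_
    by_cases h1 : κ = μ
    · subst h1; rw [if_neg (Ne.symm h)]; simp
    · rw [if_neg h1]; simp

/-- `(cAᴴcB)_{(κ,s),(κ′,s′)} = (∇_{κ′}ᴴ∇_κ)_{ss′}`. [folklore] -/
theorem cA_cB_apply (D : Fin d → Matrix S S ℂ) (κ κ' : Fin d) (s s' : S) :
    ((cA D)ᴴ * cB D) (κ, s) (κ', s') = ((D κ')ᴴ * D κ) s s' := by
  rw [Matrix.mul_apply, sum_pairs_sites]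
  simp only [cA, cB, Matrix.conjTranspose_apply, Matrix.of_apply]
  rw [Finset.sum_comm]
  -- Σ_ν Σ_μ Σ_u [κ = ν][κ' = μ] conj(∇_μ u s) ∇_ν u s'
  rw [Finset.sum_eq_single κ]
  · rw [Finset.sum_eq_single κ']
    · simp only [if_true, Matrix.mul_apply, Matrix.conjTranspose_apply]
    · intro μ _ hμ; refine Finset.sum_eq_zero fun u _ => ?_; rw [if_pos rfl, if_neg (Ne.symm hμ), mul_zero]
    · intro hk; exact absurd (Finset.mem_univ _) hk
  · intro ν _ hν; refine Finset.sum_eq_zero fun μ _ => Finset.sum_eq_zero fun u _ => ?_; rw [if_neg (Ne.symm hν)]; simp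
  · intro hk; exact absurd (Finset.mem_univ _) hk

/-- `(cBᴴcA)_{(κ,s),(κ′,s′)} = (∇_{κ′}ᴴ∇_κ)_{ss′}` as well. [folklore] -/
theorem cB_cA_apply (D : Fin d → Matrix S S ℂ) (κ κ' : Fin d) (s s' : S) :
    ((cB D)ᴴ * cA D) (κ, s) (κ', s') = ((D κ')ᴴ * D κ) s s' := by
  rw [Matrix.mul_apply, sum_pairs_sites]
  simp only [cA, cB, Matrix.conjTranspose_apply, Matrix.of_apply]
  -- Σ_μ Σ_ν Σ_u [κ = μ][κ' = ν] conj(∇_ν u s) ∇_μ u s'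
  rw [Finset.sum_eq_single κ]
  · rw [Finset.sum_eq_single κ']
    · simp only [if_true, Matrix.mul_apply, Matrix.conjTranspose_apply]
    · intro ν _ hν; refine Finset.sum_eq_zero fun u _ => ?_; rw [if_pos rfl, if_neg (Ne.symm hν), mul_zero]
    · intro hk; exact absurd (Finset.mem_univ _) hk
  · intro μ _ hμ; refine Finset.sum_eq_zero fun ν _ => Finset.sum_eq_zero fun u _ => ?_; rw [if_neg (Ne.symm hμ)]; simp
  · intro hk; exact absurd (Finset.mem_univ _) hk

/-- **THE CURL GRAM ENTRIES**: `(curlᴴcurl)_{(κ,s),(κ′,s′)} = 2·[κ = κ′]·(Σ_λ∇_λᴴ∇_λ)_{ss′} − 2·(∇_{κ′}ᴴ∇_κ)_{ss′}`. [folklore] -/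
theorem curl_gram_apply (D : Fin d → Matrix S S ℂ) (κ κ' : Fin d) (s s' : S) :
    ((curlOp D)ᴴ * curlOp D) (κ, s) (κ', s')
      = 2 * (if κ = κ' then (∑ l, (D l)ᴴ * D l) s s' else 0) - 2 * ((D κ')ᴴ * D κ) s s' := by
  rw [curlOp, Matrix.conjTranspose_sub, Matrix.sub_mul, Matrix.mul_sub, Matrix.mul_sub, Matrix.sub_apply, Matrix.sub_apply,
    Matrix.sub_apply, cA_gram_apply, cB_gram_apply, cA_cB_apply, cB_cA_apply]
  ring

/-- **THE DIVERGENCE GRAM ENTRIES**: `(divᴴdiv)_{(κ,s),(κ′,s′)} = (∇_κ∇_{κ′}ᴴ)_{ss′}`. [folklore] -/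
theorem div_gram_apply (D : Fin d → Matrix S S ℂ) (κ κ' : Fin d) (s s' : S) :
    ((divOp D)ᴴ * divOp D) (κ, s) (κ', s') = (D κ * (D κ')ᴴ) s s' := by
  rw [Matrix.mul_apply, Matrix.mul_apply]
  refine Finset.sum_congr rfl fun u _ => ?_
  simp only [divOp, Matrix.conjTranspose_apply, Matrix.of_apply, star_star]

/-- **THE LATTICE WEITZENBÖCK IDENTITY** (exact, abstract): `(1/2)•curlᴴcurl + divᴴdiv = rough + comm`, i.e. on 1-forms
`(d*d + dd*)_{νμ} = δ_{νμ}Σ_λ∇_λᴴ∇_λ + [∇_ν, ∇_μᴴ]`.  For covariant lattice differences the commutator blocks are holonomy defects times mixed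
shifts; in the flat case they vanish ([Balaban1984PropagatorsI] (1.21)/(1.69) «Δ = ∂*∂ + ∂∂*»). [folklore] -/
theorem weitzenbock (D : Fin d → Matrix S S ℂ) :
    (2 : ℂ)⁻¹ • ((curlOp D)ᴴ * curlOp D) + (divOp D)ᴴ * divOp D = roughOp D + commOp D := by
  ext ⟨κ, s⟩ ⟨κ', s'⟩
  rw [Matrix.add_apply, Matrix.smul_apply, curl_gram_apply, div_gram_apply, Matrix.add_apply]
  simp only [roughOp, commOp, oneOp, Matrix.of_apply, Matrix.sub_apply, smul_eq_mul]
  split_ifs with h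
  · ring
  · rw [Matrix.zero_apply]; ring

/-- **THE FLAT CASE**: if every `∇_ν` commutes with every `∇_μᴴ`, the Hodge form IS the rough Laplacian. [folklore] -/
theorem weitzenbock_of_commute (D : Fin d → Matrix S S ℂ) (hcomm : ∀ ν μ, D ν * (D μ)ᴴ = (D μ)ᴴ * D ν) :
    (2 : ℂ)⁻¹ • ((curlOp D)ᴴ * curlOp D) + (divOp D)ᴴ * divOp D = roughOp D := by
  rw [weitzenbock]
  have h0 : commOp D = 0 := by
    ext ⟨κ, s⟩ ⟨κ', s'⟩
    simp only [commOp, oneOp, Matrix.of_apply, hcomm, sub_self, Matrix.zero_apply]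
  rw [h0, add_zero]

/-! ## §3 Affine differences: the commutator blocks are `|c|²·[T_ν, T_μᴴ]` (holonomy defects) -/

/-- **FOR AFFINE DIFFERENCES `∇_μ = c(T_μ − 1)`** (covariant lattice differences: `T_μ = siteMul(R_μ)·S_μ`, `c = η⁻¹`) the commutator block is
`[∇_ν, ∇_μᴴ] = (c·c̄)·(T_νT_μᴴ − T_μᴴT_ν)` — `η^{−2}` times the holonomy defect around the plaquette `(μ, ν)`; it vanishes when the `T`'s commute with
the adjoints (flat case: lattice translations). [folklore] -/
theorem comm_affine [DecidableEq S] (c : ℂ) (T : Fin d → Matrix S S ℂ) (ν μ : Fin d) :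
    (c • (T ν - 1)) * (c • (T μ - 1))ᴴ - (c • (T μ - 1))ᴴ * (c • (T ν - 1))
      = (c * star c) • (T ν * (T μ)ᴴ - (T μ)ᴴ * T ν) := by
  simp only [Matrix.conjTranspose_smul, Matrix.conjTranspose_sub, Matrix.conjTranspose_one, Matrix.smul_mul, Matrix.mul_smul, smul_smul]
  rw [mul_comm (star c) c, ← smul_sub]
  congr 1
  simp only [Matrix.sub_mul, Matrix.mul_sub, Matrix.one_mul, Matrix.mul_one]
  abel

/-- hence for affine differences the Weitzenböck correction is `|c|²` times the block operator of holonomy defects. [folklore] -/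
theorem commOp_affine [DecidableEq S] (c : ℂ) (T : Fin d → Matrix S S ℂ) :
    commOp (fun μ => c • (T μ - 1)) = (c * star c) • oneOp fun ν μ => T ν * (T μ)ᴴ - (T μ)ᴴ * T ν := by
  ext ⟨κ, s⟩ ⟨κ', s'⟩
  simp only [commOp, oneOp, Matrix.of_apply, Matrix.smul_apply]
  rw [comm_affine, Matrix.smul_apply]

end Summit.QuantumFields.BalabanUV.T4Continuum.LatticeWeitzenbock

end
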